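import Summits.QuantumFields.YangMills.Theorems.BalabanUVNodesN15TwoSpacingGluingCurvedKnitCovariantAveragingDefectRows
import Summits.QuantumFields.YangMills.Theorems.BalabanUVNodesN15TwoSpacingGluingCurvedKnitSmallFieldPair
import Summits.QuantumFields.YangMills.Theorems.BalabanUVNodesN15BackgroundV1MeanGaugeLetters
import HarnessLib

/-!
# THE GLUING STEP AT TWO LATTICE SPACINGS — PROGRAMME (P-Q), XI: THE GLUED PROPAGATORS OF THE COVER AT BOTH SPACINGS WITH BAŁABAN's COVARIANT AVERAGING SUMMAND LIVE — block
# locality and the TWO inverse identities `G(Δ_U + P) = 1 = (Δ_U + P)G`, `P = N_L ⊗ 1 − N_V^Q`, on the coarse AND the fine grid (FILE 120 `uN_cvGlued_spec` ∕ FILE 122 `uN_cvGlued'_spec` with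
# their NV rows discharged; dag-n15-a `sf_cvGlued_pair_spec`'s twin)

Cell `pub-ymgap`, seat `pub-ymgap-dag-n15-c` (R134 (a); HUMAN RULING D-0062), generation 21.  `bears_on: R4∕N15 · K3⁸ SpineGivenEndpointR13SepCoPHV (stmt-QuantumFields-27366)`.
Filed `--supports stmt-QuantumFields-27366 --as helper` — COUNT-NEUTRAL.  ONE theorem; 0 `sorry`.  Imports BY NAME FILE 120∕122 (`uN_cvGlued_spec`, `uN_cvGlued'_spec`), FILE 130's dictionary,
n15-b `gaugeLetters_of_mean`, n15-c∕187b (`cv_hasMaj_sandwich_cvNVq`), 187a (`cvNVq'`, `conj_one_cvNL'_sub_cvNVq'`, `sf_rows∕cols_cvT_exp_sub_one_le`), 183 (`cvNVq`, `conj_one_cvNL_sub_cvNVq`,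
`hasMaj_sandwich_of_abs_le_one`), 182b (`hasMaj_nvQ`), `Literature…SquarefreeSums.exp_sub_one_le_two_mul`.  `sf_cvGlued_pair_spec`'s proof text with the NV rows of n15-c∕188.  Nothing in the tree is modified.

THE RESULT ★★ `sfq_cvGlued_pair_spec`: under n15-c∕188's hypotheses (skew `A′` in FILE 130's C² window at scale `r_A ≤ 1`, transporter sizes `K, K₁ ≤ 1`, `S(1+|J⊕J|) + R₁(K+K₁) ≤ R₀`,
`R₁(K+K₁) ≤ θ₀`): on the coarse grid (`U = e^{ηĀ′}`) and on the fine grid (`U′ = e^{η′A′}`) the glued operator with `P = N_L ⊗ 1 − N_V^Q`, `N_V = N_V^Q` is block-local (`≤ B e^{−δd}`) and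
is a two-sided inverse of `Δ_U ⊗… + P`.  These identities feed the `(ΔG)`-entry of (3.42) (the sequel).

HONEST FRAMING ∕ LIMITS.  MODEL operator ∕ class ∕ carriers; `Q(U)` = main term (125) of [B7] (124); the Landau summand flat; NOT any printed estimate.  NE2⁺ NOT PRINTED here; N15 of
record untouched (DISCHARGED AS CONSUMED); counts UNMOVED (typed 28∕28 · discharged 8∕28); one finite 𝕋⁴ at fixed ε per index — NOT infinite volume ∕ OS ∕ mass gap ∕ Clay.  Restate-immune.
-/

noncomputable section

open scoped BigOperators Matrix

namespace Summit.QuantumFields.YangMills.BalabanUVNodes.N15.Gluing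

open Literature.MathematicalPhysics.QuantumFieldTheory.Balaban1983to89
open Literature.MathematicalPhysics.QuantumFieldTheory.Balaban1983to89.B11SectG (BlockNorm HasMaj)
open Literature.MathematicalPhysics.QuantumFieldTheory.Balaban1983to89.B6Prop26Gluing (mulOp mulOp_apply)
open Literature.MathematicalPhysics.QuantumFieldTheory.Balaban1983to89.B6UnitTorusCarrier (unitTorusGeo unitTorusGeo_dist unitTorusGeo_dist_nonneg)
open Literature.MathematicalPhysics.QuantumFieldTheory.King1986.Torus (blockOf)
open Literature.Barriers.QuantumFields (traceForm)
open Literature.MathematicalPhysics.QuantumFieldTheory.Balaban1983to89.Beta.AveragingCorrectionJets (adCLM)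
open Summit.QuantumFields.YangMills.BalabanUVNodes.N15.BackgroundLayer (covLapM tCoefA tCoefC gavgM gaugeLetters_of_mean)
open Summit.QuantumFields.YangMills.BalabanUVNodes.N15.VectorPiece (bshiftEquiv kingPrV kingPrV_bshiftEquiv_pow fibre_conn_kingPrV bshiftEquiv_comm)
open Summit.QuantumFields.YangMills.BalabanUVNodes.N15.MatrixSpecies (mmulOp coordMat basisConst basisConst_nonneg liftBlk liftMap)
open Summit.QuantumFields.YangMills.BalabanUVNodes.N15.TwoGrid (chiCube abs_chiCube_le_one)
open Summit.QuantumFields.YangMills.BalabanUVNodes.N15.CurvedSpecies (gaugePair expTrField curvCoefC_one curvCoefA_one twoSidedLetters_curvCoef_one_of_meanGauge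
  coordMat_adCLM_transpose_eq_neg_of_conjTranspose)
open Summit.QuantumFields.YangMills.BalabanUVNodes.N15.CovAvg (hasMaj_nvQ)
open Literature.NumberTheory.Sieve.SquarefreeSums (exp_sub_one_le_two_mul)

variable {d : ℕ}

section Pair

open scoped Matrix.Norms.L2Operator

variable {L : ℕ} [NeZero L]

set_option maxHeartbeats 1600000 in
/-- ★★ **THE GLUED PROPAGATORS OF THE COVER AT BOTH SPACINGS WITH THE COVARIANT AVERAGING SUMMAND LIVE: block locality and the two inverse identities on each grid** (statement in the
module docstring; operator norms).  MODEL operator ∕ class ∕ carriers; NOT any printed estimate.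
[cite: Balaban1985BackgroundPropagators, (3.26) p.395, (3.59)–(3.60) p.402, (3.62)–(3.65) pp.402–403, (3.76)–(3.77) p.406 (mechanism); Balaban1984PropagatorsII, (2.91) p.239, (2.133)–(2.136) p.247] -/
theorem sfq_cvGlued_pair_spec (hL : Odd L ∧ 1 < L) (hL7 : 7 ≤ L) {a : ℝ} (ha : 0 < a) (ι : Type) [Fintype ι] [DecidableEq ι] :
    ∃ δ w₀ R₀ θ₀ R₁ B : ℝ, 0 < δ ∧ 0 < R₀ ∧ 0 < θ₀ ∧ 0 < R₁ ∧ 0 < B ∧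
      ∀ (mv kk r : ℕ), 1 ≤ kk → w₀ ≤ ((L ^ mv : ℕ) : ℝ) →
      ∀ {mm : Type} [Fintype mm] [DecidableEq mm] (e : Matrix mm mm ℂ ≃L[ℝ] (ι → ℝ)), (∀ A B : Matrix mm mm ℂ, traceForm A B = e A ⬝ᵥ e B) →
      ∀ (A' : Fin (d + 1) → CvX' d L mv kk r hL → Matrix mm mm ℂ), (∀ μ x', (A' μ x')ᴴ = -A' μ x') →
      ∀ (rA : ℝ), 0 ≤ rA → rA ≤ 1 → (∀ μ x', ‖A' μ x'‖ ≤ rA) →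
        (∀ μ κ x', ‖A' μ (bshiftEquiv (cvM d L mv kk hL) (L ^ r * L ^ kk) κ x') - A' μ x'‖ ≤ rA * ((((L ^ r * L ^ kk : ℕ) : ℝ))⁻¹)) →
        (∀ μ κ x', ‖(A' μ (bshiftEquiv (cvM d L mv kk hL) (L ^ r * L ^ kk) κ x') - A' μ x') -
            (A' μ (bshiftEquiv (cvM d L mv kk hL) (L ^ r * L ^ kk) κ ((bshiftEquiv (cvM d L mv kk hL) (L ^ r * L ^ kk) μ).symm x')) -
              A' μ ((bshiftEquiv (cvM d L mv kk hL) (L ^ r * L ^ kk) μ).symm x'))‖ ≤ rA * ((((L ^ r * L ^ kk : ℕ) : ℝ))⁻¹) * ((((L ^ r * L ^ kk : ℕ) : ℝ))⁻¹)) →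
        2 * ((1 + Fintype.card (Fin (d + 1))) * ((3 + 2 * ((d : ℝ) + 1)) * rA)) ≤ 1 →
        (14 * Real.exp 1 * (1 + Fintype.card (Fin (d + 1))) * basisConst e * ((1 + Fintype.card (Fin (d + 1))) * ((3 + 2 * ((d : ℝ) + 1)) * rA))) * (1 + Fintype.card (Fin (d + 1) ⊕ Fin (d + 1))) + R₁ * (((1 + Fintype.card ι * (@basisConst ι _ (Matrix mm mm ℂ) Matrix.frobeniusNormedAddCommGroup Matrix.frobeniusNormedSpace e * (2 * Real.sqrt (Fintype.card mm)) * (Real.sqrt (Fintype.card mm) * (2 * (rA * ((((L ^ kk : ℕ) : ℝ))⁻¹)))))) ^ ((d + 2) * L ^ kk) - 1) + ((1 + Fintype.card ι * (@basisConst ι _ (Matrix mm mm ℂ) Matrix.frobeniusNormedAddCommGroup Matrix.frobeniusNormedSpace e * (2 * Real.sqrt (Fintype.card mm)) * (Real.sqrt (Fintype.card mm) * (2 * (rA * ((((L ^ r * L ^ kk : ℕ) : ℝ))⁻¹)))))) ^ ((d + 2) * (L ^ r * L ^ kk)) - 1)) ≤ R₀ →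
        R₁ * (((1 + Fintype.card ι * (@basisConst ι _ (Matrix mm mm ℂ) Matrix.frobeniusNormedAddCommGroup Matrix.frobeniusNormedSpace e * (2 * Real.sqrt (Fintype.card mm)) * (Real.sqrt (Fintype.card mm) * (2 * (rA * ((((L ^ kk : ℕ) : ℝ))⁻¹)))))) ^ ((d + 2) * L ^ kk) - 1) + ((1 + Fintype.card ι * (@basisConst ι _ (Matrix mm mm ℂ) Matrix.frobeniusNormedAddCommGroup Matrix.frobeniusNormedSpace e * (2 * Real.sqrt (Fintype.card mm)) * (Real.sqrt (Fintype.card mm) * (2 * (rA * ((((L ^ r * L ^ kk : ℕ) : ℝ))⁻¹)))))) ^ ((d + 2) * (L ^ r * L ^ kk)) - 1)) ≤ θ₀ → ((1 + Fintype.card ι * (@basisConst ι _ (Matrix mm mm ℂ) Matrix.frobeniusNormedAddCommGroup Matrix.frobeniusNormedSpace e * (2 * Real.sqrt (Fintype.card mm)) * (Real.sqrt (Fintype.card mm) * (2 * (rA * ((((L ^ kk : ℕ) : ℝ))⁻¹)))))) ^ ((d + 2) * L ^ kk) - 1) ≤ 1 → ((1 + Fintype.card ι * (@basisConst ι _ (Matrix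 mm mm ℂ) Matrix.frobeniusNormedAddCommGroup Matrix.frobeniusNormedSpace e * (2 * Real.sqrt (Fintype.card mm)) * (Real.sqrt (Fintype.card mm) * (2 * (rA * ((((L ^ r * L ^ kk : ℕ) : ℝ))⁻¹)))))) ^ ((d + 2) * (L ^ r * L ^ kk)) - 1) ≤ 1 →
        (HasMaj (CvNorm d L mv kk hL ι) (CvNorm d L mv kk hL ι) (cvGlued d L mv kk hL a ((((L ^ kk : ℕ) : ℝ))⁻¹) ι e (fun _ _ => (1 : Matrix mm mm ℂ)) (fun μ x => NormedSpace.exp (((((L ^ kk : ℕ) : ℝ))⁻¹) • gavgM (Matrix mm mm ℂ) (Fin (d + 1)) (kingPrV L kk r (cvM d L mv kk hL)) A' μ x)) (cvNL d L mv kk hL a ι - (cvNVq d L mv kk hL a ι e (fun μ x => NormedSpace.exp (((((L ^ kk : ℕ) : ℝ))⁻¹) • gavgM (Matrix mm mm ℂ) (Fin (d + 1)) (kingPrV L kk r (cvM d L mv kk hL)) A' μ x)))) (fun _ => (cvNVq d L mv kk hL a ι e (fun μ x => NormedSpace.exp (((((L ^ kk : ℕ) : ℝ))⁻¹) • gavgM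 (Matrix mm mm ℂ) (Fin (d + 1)) (kingPrV L kk r (cvM d L mv kk hL)) A' μ x)))))
          (fun y y' => B * Real.exp (-(δ * (unitTorusGeo L kk (cvM d L mv kk hL)).dist y y'))) ∧
        (cvGlued d L mv kk hL a ((((L ^ kk : ℕ) : ℝ))⁻¹) ι e (fun _ _ => (1 : Matrix mm mm ℂ)) (fun μ x => NormedSpace.exp (((((L ^ kk : ℕ) : ℝ))⁻¹) • gavgM (Matrix mm mm ℂ) (Fin (d + 1)) (kingPrV L kk r (cvM d L mv kk hL)) A' μ x)) (cvNL d L mv kk hL a ι - (cvNVq d L mv kk hL a ι e (fun μ x => NormedSpace.exp (((((L ^ kk : ℕ) : ℝ))⁻¹) • gavgM (Matrix mm mm ℂ) (Fin (d + 1)) (kingPrV L kk r (cvM d L mv kk hL)) A' μ x)))) (fun _ => (cvNVq d L mv kk hL a ι e (fun μ x => NormedSpace.exp (((((L ^ kk : ℕ) : ℝ))⁻¹) • gavgM (Matrix mm mm ℂ) (Fin (d + 1)) (kingPrV L kk r (cvM d L mv kk hL)) A' μ x)))) ∘ₗ (covLapM (bshiftEquiv (cvM d L mv kk hL) (L ^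 kk)) ((((L ^ kk : ℕ) : ℝ))⁻¹) (gaugePair (bshiftEquiv (cvM d L mv kk hL) (L ^ kk)) (fun μ x => coordMat e (ContinuousLinearMap.mulLeftRight ℝ (Matrix mm mm ℂ) (NormedSpace.exp (((((L ^ kk : ℕ) : ℝ))⁻¹) • gavgM (Matrix mm mm ℂ) (Fin (d + 1)) (kingPrV L kk r (cvM d L mv kk hL)) A' μ x)) (NormedSpace.exp (((((L ^ kk : ℕ) : ℝ))⁻¹) • gavgM (Matrix mm mm ℂ) (Fin (d + 1)) (kingPrV L kk r (cvM d L mv kk hL)) A' μ x))ᴴ))) + (cvNL d L mv kk hL a ι - (cvNVq d L mv kk hL a ι e (fun μ x => NormedSpace.exp (((((L ^ kk : ℕ) : ℝ))⁻¹) • gavgM (Matrix mm mm ℂ) (Fin (d + 1)) (kingPrV L kk r (cvM d L mv kk hL)) A' μ x))))) = LinearMap.id ∧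
          (covLapM (bshiftEquiv (cvM d L mv kk hL) (L ^ kk)) ((((L ^ kk : ℕ) : ℝ))⁻¹) (gaugePair (bshiftEquiv (cvM d L mv kk hL) (L ^ kk)) (fun μ x => coordMat e (ContinuousLinearMap.mulLeftRight ℝ (Matrix mm mm ℂ) (NormedSpace.exp (((((L ^ kk : ℕ) : ℝ))⁻¹) • gavgM (Matrix mm mm ℂ) (Fin (d + 1)) (kingPrV L kk r (cvM d L mv kk hL)) A' μ x)) (NormedSpace.exp (((((L ^ kk : ℕ) : ℝ))⁻¹) • gavgM (Matrix mm mm ℂ) (Fin (d + 1)) (kingPrV L kk r (cvM d L mv kk hL)) A' μ x))ᴴ))) + (cvNL d L mv kk hL a ι - (cvNVq d L mv kk hL a ι e (fun μ x => NormedSpace.exp (((((L ^ kk : ℕ) : ℝ))⁻¹) • gavgM (Matrix mm mm ℂ) (Fin (d + 1)) (kingPrV L kk r (cvM d L mv kk hL)) A' μ x))))) ∘ₗ cvGlued d L mv kk hL a ((((L ^ kk : ℕ) : ℝ))⁻¹) ι e (fun _ _ => (1 : Matrix mm mm ℂ)) (fun μ x => NormedSpace.exp (((((L ^ kk : ℕ)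 : ℝ))⁻¹) • gavgM (Matrix mm mm ℂ) (Fin (d + 1)) (kingPrV L kk r (cvM d L mv kk hL)) A' μ x)) (cvNL d L mv kk hL a ι - (cvNVq d L mv kk hL a ι e (fun μ x => NormedSpace.exp (((((L ^ kk : ℕ) : ℝ))⁻¹) • gavgM (Matrix mm mm ℂ) (Fin (d + 1)) (kingPrV L kk r (cvM d L mv kk hL)) A' μ x)))) (fun _ => (cvNVq d L mv kk hL a ι e (fun μ x => NormedSpace.exp (((((L ^ kk : ℕ) : ℝ))⁻¹) • gavgM (Matrix mm mm ℂ) (Fin (d + 1)) (kingPrV L kk r (cvM d L mv kk hL)) A' μ x)))) = LinearMap.id) ) ∧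
        (HasMaj (BlockNorm.ofBlocks (unitTorusGeo L kk (cvM d L mv kk hL)) (liftBlk (fun b : CvX' d L mv kk r hL => blockOf (L ^ r * L ^ kk) (cvM d L mv kk hL) b.1) ι)) (BlockNorm.ofBlocks (unitTorusGeo L kk (cvM d L mv kk hL)) (liftBlk (fun b : CvX' d L mv kk r hL => blockOf (L ^ r * L ^ kk) (cvM d L mv kk hL) b.1) ι)) (cvGlued' d L mv kk r hL a ((((L ^ r * L ^ kk : ℕ) : ℝ))⁻¹) ι e (fun _ _ => (1 : Matrix mm mm ℂ)) (fun μ x' => NormedSpace.exp (((((L ^ r * L ^ kk : ℕ) : ℝ))⁻¹) • A' μ x')) (cvNL' d L mv kk r hL a ι - (cvNVq' d L mv kk r hL a ι e (fun μ x' => NormedSpace.exp (((((L ^ r * L ^ kk : ℕ) : ℝ))⁻¹) • A' μ x')))) (fun _ => (cvNVq' d L mv kk r hL a ι e (fun μ x' => NormedSpace.exp (((((L ^ r * L ^ kk : ℕ) : ℝ))⁻¹) • A' μ x')))))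
          (fun y y' => B * Real.exp (-(δ * (unitTorusGeo L kk (cvM d L mv kk hL)).dist y y'))) ∧
        (cvGlued' d L mv kk r hL a ((((L ^ r * L ^ kk : ℕ) : ℝ))⁻¹) ι e (fun _ _ => (1 : Matrix mm mm ℂ)) (fun μ x' => NormedSpace.exp (((((L ^ r * L ^ kk : ℕ) : ℝ))⁻¹) • A' μ x')) (cvNL' d L mv kk r hL a ι - (cvNVq' d L mv kk r hL a ι e (fun μ x' => NormedSpace.exp (((((L ^ r * L ^ kk : ℕ) : ℝ))⁻¹) • A' μ x')))) (fun _ => (cvNVq' d L mv kk r hL a ι e (fun μ x' => NormedSpace.exp (((((L ^ r * L ^ kk : ℕ) : ℝ))⁻¹) • A' μ x')))) ∘ₗ (covLapM (bshiftEquiv (cvM d L mv kk hL) (L ^ r * L ^ kk)) ((((L ^ r * L ^ kk : ℕ) : ℝ))⁻¹) (gaugePair (bshiftEquiv (cvM d L mv kk hL) (L ^ r * L ^ kk)) (fun μ x' => coordMat e (ContinuousLinearMap.mulLeftRight ℝ (Matrix mm mm ℂ) (NormedSpace.exp (((((L ^ r * L ^ kk : ℕ) : ℝ))⁻¹) • A'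 μ x')) (NormedSpace.exp (((((L ^ r * L ^ kk : ℕ) : ℝ))⁻¹) • A' μ x'))ᴴ))) + (cvNL' d L mv kk r hL a ι - (cvNVq' d L mv kk r hL a ι e (fun μ x' => NormedSpace.exp (((((L ^ r * L ^ kk : ℕ) : ℝ))⁻¹) • A' μ x'))))) = LinearMap.id ∧
          (covLapM (bshiftEquiv (cvM d L mv kk hL) (L ^ r * L ^ kk)) ((((L ^ r * L ^ kk : ℕ) : ℝ))⁻¹) (gaugePair (bshiftEquiv (cvM d L mv kk hL) (L ^ r * L ^ kk)) (fun μ x' => coordMat e (ContinuousLinearMap.mulLeftRight ℝ (Matrix mm mm ℂ) (NormedSpace.exp (((((L ^ r * L ^ kk : ℕ) : ℝ))⁻¹) • A' μ x')) (NormedSpace.exp (((((L ^ r * L ^ kk : ℕ) : ℝ))⁻¹) • A' μ x'))ᴴ))) + (cvNL' d L mv kk r hL a ι - (cvNVq' d L mv kk r hL a ι e (fun μ x' => NormedSpace.exp (((((L ^ r * L ^ kk : ℕ) : ℝ))⁻¹) • A' μ x'))))) ∘ₗ cvGlued' d L mv kk r hL a ((((L ^ r * L ^ kk : ℕ) : ℝ))⁻¹)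 ι e (fun _ _ => (1 : Matrix mm mm ℂ)) (fun μ x' => NormedSpace.exp (((((L ^ r * L ^ kk : ℕ) : ℝ))⁻¹) • A' μ x')) (cvNL' d L mv kk r hL a ι - (cvNVq' d L mv kk r hL a ι e (fun μ x' => NormedSpace.exp (((((L ^ r * L ^ kk : ℕ) : ℝ))⁻¹) • A' μ x')))) (fun _ => (cvNVq' d L mv kk r hL a ι e (fun μ x' => NormedSpace.exp (((((L ^ r * L ^ kk : ℕ) : ℝ))⁻¹) • A' μ x')))) = LinearMap.id) ) := by
  have hLpos : 0 < L := Nat.pos_of_ne_zero (NeZero.ne L)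
  obtain ⟨δ₁, w₁, R₁', θ₁, B₁, hδ₁, hR₁', hθ₁, hB₁, H₁⟩ := uN_cvGlued_spec (d := d) hL hL7 ha ι
  obtain ⟨δ₂, w₂, R₂, θ₂, B₂, hδ₂, hR₂, hθ₂, hB₂, H₂⟩ := uN_cvGlued'_spec (d := d) hL hL7 ha ι
  have hc10 : 0 ≤ B4Sect5Proof.latticeConst (d + 1) δ₁ := B4Sect5Proof.latticeConst_nonneg (d + 1) hδ₁.le
  have hc20 : 0 ≤ B4Sect5Proof.latticeConst (d + 1) δ₂ := B4Sect5Proof.latticeConst_nonneg (d + 1) hδ₂.le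
  refine ⟨min (δ₁ / 16) (δ₂ / 16), max w₁ w₂, min R₁' R₂, min θ₁ θ₂, 3 * |a| * ((B4Sect5Proof.latticeConst (d + 1) δ₁ * Real.exp (3 * δ₁)) + (B4Sect5Proof.latticeConst (d + 1) δ₂ * Real.exp (3 * δ₂))) + 1, max B₁ B₂, lt_min (by positivity) (by positivity), lt_min hR₁' hR₂, lt_min hθ₁ hθ₂,
    by positivity, lt_max_of_lt_left hB₁, fun mv kk r hk hw₀ => ?_⟩
  set Rq : ℝ := 3 * |a| * ((B4Sect5Proof.latticeConst (d + 1) δ₁ * Real.exp (3 * δ₁)) + (B4Sect5Proof.latticeConst (d + 1) δ₂ * Real.exp (3 * δ₂))) + 1 with hRqdef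
  intro mm _ _ e he A' hA' rA hrA hrA1 h1 h2 h3 hr2 hRle hθle hKc hKf
  have hw₁ : w₁ ≤ ((L ^ mv : ℕ) : ℝ) := (le_max_left _ _).trans hw₀
  have hw₂ : w₂ ≤ ((L ^ mv : ℕ) : ℝ) := (le_max_right _ _).trans hw₀
  -- the two spacings
  have hkpos : (0 : ℝ) < ((L ^ kk : ℕ) : ℝ) := Nat.cast_pos.mpr (pow_pos hLpos kk)
  have hrkpos : (0 : ℝ) < ((L ^ r * L ^ kk : ℕ) : ℝ) := Nat.cast_pos.mpr (Nat.mul_pos (pow_pos hLpos r) (pow_pos hLpos kk))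
  have hη : (0 : ℝ) < ((((L ^ kk : ℕ) : ℝ))⁻¹) := inv_pos.mpr hkpos
  have hη' : (0 : ℝ) < ((((L ^ r * L ^ kk : ℕ) : ℝ))⁻¹) := inv_pos.mpr hrkpos
  have hN : ((((L ^ kk : ℕ) : ℝ))⁻¹) = ((L ^ r : ℕ) : ℝ) * ((((L ^ r * L ^ kk : ℕ) : ℝ))⁻¹) := by
    have hr0 : ((L ^ r : ℕ) : ℝ) ≠ 0 := Nat.cast_ne_zero.mpr (pow_ne_zero _ (NeZero.ne L))
    rw [Nat.cast_mul]; field_simp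
  have hη1 : ((((L ^ kk : ℕ) : ℝ))⁻¹) ≤ 1 := inv_le_one_of_one_le₀ (by exact_mod_cast Nat.one_le_pow kk L hLpos)
  have hη'1 : ((((L ^ r * L ^ kk : ℕ) : ℝ))⁻¹) ≤ 1 := inv_le_one_of_one_le₀ (by exact_mod_cast Nat.mul_pos (Nat.one_le_pow r L hLpos) (Nat.one_le_pow kk L hLpos))
  have hC₀ : (0 : ℝ) ≤ 2 * ((d : ℝ) + 1) := by positivity
  have hCθ : (((2 * ((d + 1) * (L ^ r - 1)) : ℕ) : ℝ)) * ((((L ^ r * L ^ kk : ℕ) : ℝ))⁻¹) ≤ 2 * ((d : ℝ) + 1) * ((((L ^ kk : ℕ) : ℝ))⁻¹) := by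
    have hsub : (((L ^ r - 1 : ℕ)) : ℝ) ≤ ((L ^ r : ℕ) : ℝ) := by exact_mod_cast Nat.sub_le _ _
    have hcast : (((2 * ((d + 1) * (L ^ r - 1)) : ℕ) : ℝ)) = 2 * ((d : ℝ) + 1) * (((L ^ r - 1 : ℕ)) : ℝ) := by push_cast; ring
    rw [hcast, hN]
    calc 2 * ((d : ℝ) + 1) * (((L ^ r - 1 : ℕ)) : ℝ) * ((((L ^ r * L ^ kk : ℕ) : ℝ))⁻¹) ≤ 2 * ((d : ℝ) + 1) * ((L ^ r : ℕ) : ℝ) * ((((L ^ r * L ^ kk : ℕ) : ℝ))⁻¹) :=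
          mul_le_mul_of_nonneg_right (mul_le_mul_of_nonneg_left hsub hC₀) hη'.le
      _ = 2 * ((d : ℝ) + 1) * (((L ^ r : ℕ) : ℝ) * ((((L ^ r * L ^ kk : ℕ) : ℝ))⁻¹)) := by ring
  -- King's pairing geometry and skewness in coordinates; the sup of the block mean
  have hcomm := fun μ κ (x : CvX' d L mv kk r hL) => bshiftEquiv_comm (cvM d L mv kk hL) (L ^ r * L ^ kk) μ κ x
  have hconn := fun (f : CvX' d L mv kk r hL → Matrix mm mm ℂ) (β : ℝ)
      (hf : ∀ κ x, ‖f (bshiftEquiv (cvM d L mv kk hL) (L ^ r * L ^ kk) κ x) - f x‖ ≤ β) => fibre_conn_kingPrV L kk r (cvM d L mv kk hL) f β hf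
  have hblk := fun μ (x' : CvX' d L mv kk r hL) => kingPrV_bshiftEquiv_pow L kk r (cvM d L mv kk hL) μ x'
  have hAm : ∀ μ x, (gavgM (Matrix mm mm ℂ) (Fin (d + 1)) (kingPrV L kk r (cvM d L mv kk hL)) A' μ x)ᴴ = -gavgM (Matrix mm mm ℂ) (Fin (d + 1)) (kingPrV L kk r (cvM d L mv kk hL)) A' μ x := gavgM_conjTranspose_of_skew (kingPrV L kk r (cvM d L mv kk hL)) hA'
  have hA'c := fun μ x' => coordMat_adCLM_transpose_eq_neg_of_conjTranspose e he (hA' μ x')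
  have hAmc := fun μ x => coordMat_adCLM_transpose_eq_neg_of_conjTranspose e he (hAm μ x)
  obtain ⟨g1, -, -, -, -, -⟩ := gaugeLetters_of_mean (π := (kingPrV L kk r (cvM d L mv kk hL))) (s := bshiftEquiv (cvM d L mv kk hL) (L ^ kk))
    (s' := bshiftEquiv (cvM d L mv kk hL) (L ^ r * L ^ kk)) (N := L ^ r) (Cπ := (((2 * ((d + 1) * (L ^ r - 1)) : ℕ) : ℝ))) hcomm hconn hblk hη' hN hη hrA h1 h2 h3
  obtain ⟨hc, hcA, hc', hcA', -, -, -, -, -, -, -, -, -, -, -⟩ :=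
    twoSidedLetters_curvCoef_one_of_meanGauge e (π := (kingPrV L kk r (cvM d L mv kk hL))) (s := bshiftEquiv (cvM d L mv kk hL) (L ^ kk))
      (s' := bshiftEquiv (cvM d L mv kk hL) (L ^ r * L ^ kk)) (N := L ^ r) (θ := ((((L ^ kk : ℕ) : ℝ))⁻¹)) (Cπ := (((2 * ((d + 1) * (L ^ r - 1)) : ℕ) : ℝ))) (C₀ := 2 * ((d : ℝ) + 1))
      hcomm hconn hblk hη' hN hη hη1 le_rfl hC₀ hCθ hrA hr2 hA'c hAmc h1 h2 h3
  have hce : ∀ {X : Type} (η : ℝ) {A : Fin (d + 1) → X → Matrix mm mm ℂ}, (∀ μ x, (A μ x)ᴴ = -A μ x) →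
      (fun μ x => coordMat e (ContinuousLinearMap.mulLeftRight ℝ (Matrix mm mm ℂ) ((1 : Matrix mm mm ℂ) * NormedSpace.exp (η • A μ x) * (1 : Matrix mm mm ℂ)ᴴ)
        ((1 : Matrix mm mm ℂ) * NormedSpace.exp (η • A μ x) * (1 : Matrix mm mm ℂ)ᴴ)ᴴ)) = expTrField e η (fun μ x => adCLM ℝ (A μ x)) :=
    fun η _ hA => conj_one_exp_eq_expTrField e η hA
  rw [curvCoefC_one, curvCoefA_one, ← hce ((((L ^ kk : ℕ) : ℝ))⁻¹) hAm] at hc hcA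
  rw [curvCoefC_one, curvCoefA_one, ← hce ((((L ^ r * L ^ kk : ℕ) : ℝ))⁻¹) hA'] at hc' hcA'
  have hκ0 : 0 ≤ basisConst e := basisConst_nonneg e
  have hκF := @basisConst_nonneg ι _ (Matrix mm mm ℂ) Matrix.frobeniusNormedAddCommGroup Matrix.frobeniusNormedSpace e
  have hS0 : 0 ≤ (14 * Real.exp 1 * (1 + Fintype.card (Fin (d + 1))) * basisConst e * ((1 + Fintype.card (Fin (d + 1))) * ((3 + 2 * ((d : ℝ) + 1)) * rA))) := by positivity
  -- the cuts
  have hχ1 : ∀ (k : Fin (d + 1) → ZMod (2 * L)) (x : CvX d L mv kk hL), |cvChi d L mv kk hL k x| ≤ 1 := fun k x => abs_chiCube_le_one _ x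
  have hψ1 : ∀ (k : Fin (d + 1) → ZMod (2 * L)) (x : CvX d L mv kk hL), |cvPsi d L mv kk hL k x| ≤ 1 := fun k x => abs_chiCube_le_one _ x
  have hχ1' : ∀ (k : Fin (d + 1) → ZMod (2 * L)) (x' : CvX' d L mv kk r hL), |cvChi' d L mv kk r hL k x'| ≤ 1 := fun k x' => abs_chiCube_le_one _ x'
  have hψ1' : ∀ (k : Fin (d + 1) → ZMod (2 * L)) (x' : CvX' d L mv kk r hL), |cvPsi' d L mv kk r hL k x'| ≤ 1 := fun k x' => abs_chiCube_le_one _ x'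
  have h1ψ : ∀ (k : Fin (d + 1) → ZMod (2 * L)) (x : CvX d L mv kk hL), |(1 - cvPsi d L mv kk hL k) x| ≤ 1 := fun k x => by
    rw [Pi.sub_apply, Pi.one_apply]; unfold cvPsi chiCube; split_ifs <;> simp
  have h1ψ' : ∀ (k : Fin (d + 1) → ZMod (2 * L)) (x' : CvX' d L mv kk r hL), |(1 - cvPsi' d L mv kk r hL k) x'| ≤ 1 := fun k x' => by
    rw [Pi.sub_apply, Pi.one_apply]; unfold cvPsi' chiCube; split_ifs <;> simp
  have hid : ∀ k : Fin (d + 1) → ZMod (2 * L), (LinearMap.id - mulOp (fun p : CvX d L mv kk hL × ι => cvPsi d L mv kk hL k p.1)) =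
      mulOp (fun p : CvX d L mv kk hL × ι => (1 - cvPsi d L mv kk hL k) p.1) := fun k =>
    LinearMap.ext fun f => funext fun p => by simp [mulOp_apply, sub_mul]
  have hid' : ∀ k : Fin (d + 1) → ZMod (2 * L), (LinearMap.id - mulOp (fun p : CvX' d L mv kk r hL × ι => cvPsi' d L mv kk r hL k p.1)) =
      mulOp (fun p : CvX' d L mv kk r hL × ι => (1 - cvPsi' d L mv kk r hL k) p.1) := fun k =>
    LinearMap.ext fun f => funext fun p => by simp [mulOp_apply, sub_mul]
  -- (P-Q) the transporter letters of `e^{ηĀ′}`, `e^{η′A′}`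
  have hexpc : Real.exp (((((L ^ kk : ℕ) : ℝ))⁻¹) * rA) - 1 ≤ 2 * (rA * ((((L ^ kk : ℕ) : ℝ))⁻¹)) := by
    have h := exp_sub_one_le_two_mul (x := ((((L ^ kk : ℕ) : ℝ))⁻¹) * rA) (by positivity) (mul_le_one₀ hη1 hrA hrA1); linarith [mul_comm ((((L ^ kk : ℕ) : ℝ))⁻¹) rA]
  have hexpf : Real.exp (((((L ^ r * L ^ kk : ℕ) : ℝ))⁻¹) * rA) - 1 ≤ 2 * (rA * ((((L ^ r * L ^ kk : ℕ) : ℝ))⁻¹)) := by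
    have h := exp_sub_one_le_two_mul (x := ((((L ^ r * L ^ kk : ℕ) : ℝ))⁻¹) * rA) (by positivity) (mul_le_one₀ hη'1 hrA hrA1); linarith [mul_comm ((((L ^ r * L ^ kk : ℕ) : ℝ))⁻¹) rA]
  have hTr : ∀ μ p i, ∑ j, |(cvT e (fun μ x => NormedSpace.exp (((((L ^ kk : ℕ) : ℝ))⁻¹) • gavgM (Matrix mm mm ℂ) (Fin (d + 1)) (kingPrV L kk r (cvM d L mv kk hL)) A' μ x)) μ p - 1) i j| ≤ Fintype.card ι * (@basisConst ι _ (Matrix mm mm ℂ) Matrix.frobeniusNormedAddCommGroup Matrix.frobeniusNormedSpace e * (2 * Real.sqrt (Fintype.card mm)) * (Real.sqrt (Fintype.card mm) * (2 * (rA * ((((L ^ kk : ℕ) : ℝ))⁻¹))))) := fun μ p i =>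
    (sf_rows_cvT_exp_sub_one_le e hη.le hAm g1 μ p i).trans (by gcongr)
  have hTc : ∀ μ p j, ∑ i, |(cvT e (fun μ x => NormedSpace.exp (((((L ^ kk : ℕ) : ℝ))⁻¹) • gavgM (Matrix mm mm ℂ) (Fin (d + 1)) (kingPrV L kk r (cvM d L mv kk hL)) A' μ x)) μ p - 1) i j| ≤ Fintype.card ι * (@basisConst ι _ (Matrix mm mm ℂ) Matrix.frobeniusNormedAddCommGroup Matrix.frobeniusNormedSpace e * (2 * Real.sqrt (Fintype.card mm)) * (Real.sqrt (Fintype.card mm) * (2 * (rA * ((((L ^ kk : ℕ) : ℝ))⁻¹))))) := fun μ p j =>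
    (sf_cols_cvT_exp_sub_one_le e hη.le hAm g1 μ p j).trans (by gcongr)
  have hTr' : ∀ μ p i, ∑ j, |(cvT e (fun μ x' => NormedSpace.exp (((((L ^ r * L ^ kk : ℕ) : ℝ))⁻¹) • A' μ x')) μ p - 1) i j| ≤ Fintype.card ι * (@basisConst ι _ (Matrix mm mm ℂ) Matrix.frobeniusNormedAddCommGroup Matrix.frobeniusNormedSpace e * (2 * Real.sqrt (Fintype.card mm)) * (Real.sqrt (Fintype.card mm) * (2 * (rA * ((((L ^ r * L ^ kk : ℕ) : ℝ))⁻¹))))) := fun μ p i =>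
    (sf_rows_cvT_exp_sub_one_le e hη'.le hA' h1 μ p i).trans (by gcongr)
  have hTc' : ∀ μ p j, ∑ i, |(cvT e (fun μ x' => NormedSpace.exp (((((L ^ r * L ^ kk : ℕ) : ℝ))⁻¹) • A' μ x')) μ p - 1) i j| ≤ Fintype.card ι * (@basisConst ι _ (Matrix mm mm ℂ) Matrix.frobeniusNormedAddCommGroup Matrix.frobeniusNormedSpace e * (2 * Real.sqrt (Fintype.card mm)) * (Real.sqrt (Fintype.card mm) * (2 * (rA * ((((L ^ r * L ^ kk : ℕ) : ℝ))⁻¹))))) := fun μ p j =>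
    (sf_cols_cvT_exp_sub_one_le e hη'.le hA' h1 μ p j).trans (by gcongr)
  have hρc0 : 0 ≤ Fintype.card ι * (@basisConst ι _ (Matrix mm mm ℂ) Matrix.frobeniusNormedAddCommGroup Matrix.frobeniusNormedSpace e * (2 * Real.sqrt (Fintype.card mm)) * (Real.sqrt (Fintype.card mm) * (2 * (rA * ((((L ^ kk : ℕ) : ℝ))⁻¹))))) := by positivity
  have hρf0 : 0 ≤ Fintype.card ι * (@basisConst ι _ (Matrix mm mm ℂ) Matrix.frobeniusNormedAddCommGroup Matrix.frobeniusNormedSpace e * (2 * Real.sqrt (Fintype.card mm)) * (Real.sqrt (Fintype.card mm) * (2 * (rA * ((((L ^ r * L ^ kk : ℕ) : ℝ))⁻¹))))) := by positivity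
  -- (P-Q) the constants against `R₁(K + K₁)`
  have hce1 : 0 ≤ (B4Sect5Proof.latticeConst (d + 1) δ₁ * Real.exp (3 * δ₁)) := mul_nonneg hc10 (Real.exp_nonneg _)
  have hce2 : 0 ≤ (B4Sect5Proof.latticeConst (d + 1) δ₂ * Real.exp (3 * δ₂)) := mul_nonneg hc20 (Real.exp_nonneg _)
  have hRq0 : 0 ≤ Rq := by rw [hRqdef]; positivity
  have hKC0 : 0 ≤ ((1 + Fintype.card ι * (@basisConst ι _ (Matrix mm mm ℂ) Matrix.frobeniusNormedAddCommGroup Matrix.frobeniusNormedSpace e * (2 * Real.sqrt (Fintype.card mm)) * (Real.sqrt (Fintype.card mm) * (2 * (rA * ((((L ^ kk : ℕ) : ℝ))⁻¹)))))) ^ ((d + 2) * L ^ kk) - 1) := by have := one_le_pow₀ (M₀ := ℝ) (a := 1 + Fintype.card ι * (@basisConst ι _ (Matrix mm mm ℂ) Matrix.frobeniusNormedAddCommGroup Matrix.frobeniusNormedSpace e * (2 * Real.sqrt (Fintype.card mm)) * (Real.sqrt (Fintype.card mm) * (2 * (rA * ((((L ^ kk : ℕ) : ℝ))⁻¹))))))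 (by linarith) (n := (d + 2) * L ^ kk); linarith
  have hKF0 : 0 ≤ ((1 + Fintype.card ι * (@basisConst ι _ (Matrix mm mm ℂ) Matrix.frobeniusNormedAddCommGroup Matrix.frobeniusNormedSpace e * (2 * Real.sqrt (Fintype.card mm)) * (Real.sqrt (Fintype.card mm) * (2 * (rA * ((((L ^ r * L ^ kk : ℕ) : ℝ))⁻¹)))))) ^ ((d + 2) * (L ^ r * L ^ kk)) - 1) := by have := one_le_pow₀ (M₀ := ℝ) (a := 1 + Fintype.card ι * (@basisConst ι _ (Matrix mm mm ℂ) Matrix.frobeniusNormedAddCommGroup Matrix.frobeniusNormedSpace e * (2 * Real.sqrt (Fintype.card mm)) * (Real.sqrt (Fintype.card mm) * (2 * (rA * ((((L ^ r * L ^ kk : ℕ) : ℝ))⁻¹)))))) (by linarith) (n := (d + 2) * (L ^ r * L ^ kk)); linarith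
  have hconstC : |a| * (((1 + Fintype.card ι * (@basisConst ι _ (Matrix mm mm ℂ) Matrix.frobeniusNormedAddCommGroup Matrix.frobeniusNormedSpace e * (2 * Real.sqrt (Fintype.card mm)) * (Real.sqrt (Fintype.card mm) * (2 * (rA * ((((L ^ kk : ℕ) : ℝ))⁻¹)))))) ^ ((d + 2) * L ^ kk) - 1) * (2 + ((1 + Fintype.card ι * (@basisConst ι _ (Matrix mm mm ℂ) Matrix.frobeniusNormedAddCommGroup Matrix.frobeniusNormedSpace e * (2 * Real.sqrt (Fintype.card mm)) * (Real.sqrt (Fintype.card mm) * (2 * (rA * ((((L ^ kk : ℕ) : ℝ))⁻¹)))))) ^ ((d + 2) * L ^ kk) - 1)) * (B4Sect5Proof.latticeConst (d + 1) δ₁ * Real.exp (3 * δ₁))) ≤ Rq * (((1 + Fintype.card ι * (@basisConst ι _ (Matrix mm mm ℂ) Matrix.frobeniusNormedAddCommGroup Matrix.frobeniusNormedSpace e * (2 * Real.sqrt (Fintype.card mm)) * (Real.sqrt (Fintype.card mm) * (2 * (rA * ((((L ^ kk : ℕ) : ℝ))⁻¹)))))) ^ ((d + 2) * L ^ kk)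 - 1) + ((1 + Fintype.card ι * (@basisConst ι _ (Matrix mm mm ℂ) Matrix.frobeniusNormedAddCommGroup Matrix.frobeniusNormedSpace e * (2 * Real.sqrt (Fintype.card mm)) * (Real.sqrt (Fintype.card mm) * (2 * (rA * ((((L ^ r * L ^ kk : ℕ) : ℝ))⁻¹)))))) ^ ((d + 2) * (L ^ r * L ^ kk)) - 1)) := by
    have h3 : ((1 + Fintype.card ι * (@basisConst ι _ (Matrix mm mm ℂ) Matrix.frobeniusNormedAddCommGroup Matrix.frobeniusNormedSpace e * (2 * Real.sqrt (Fintype.card mm)) * (Real.sqrt (Fintype.card mm) * (2 * (rA * ((((L ^ kk : ℕ) : ℝ))⁻¹)))))) ^ ((d + 2) * L ^ kk) - 1) * (2 + ((1 + Fintype.card ι * (@basisConst ι _ (Matrix mm mm ℂ) Matrix.frobeniusNormedAddCommGroup Matrix.frobeniusNormedSpace e * (2 * Real.sqrt (Fintype.card mm)) * (Real.sqrt (Fintype.card mm) * (2 * (rA * ((((L ^ kk : ℕ) : ℝ))⁻¹)))))) ^ ((d + 2) * L ^ kk) - 1)) ≤ 3 * ((1 + Fintype.card ι * (@basisConst ι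 _ (Matrix mm mm ℂ) Matrix.frobeniusNormedAddCommGroup Matrix.frobeniusNormedSpace e * (2 * Real.sqrt (Fintype.card mm)) * (Real.sqrt (Fintype.card mm) * (2 * (rA * ((((L ^ kk : ℕ) : ℝ))⁻¹)))))) ^ ((d + 2) * L ^ kk) - 1) := by nlinarith
    calc |a| * (((1 + Fintype.card ι * (@basisConst ι _ (Matrix mm mm ℂ) Matrix.frobeniusNormedAddCommGroup Matrix.frobeniusNormedSpace e * (2 * Real.sqrt (Fintype.card mm)) * (Real.sqrt (Fintype.card mm) * (2 * (rA * ((((L ^ kk : ℕ) : ℝ))⁻¹)))))) ^ ((d + 2) * L ^ kk) - 1) * (2 + ((1 + Fintype.card ι * (@basisConst ι _ (Matrix mm mm ℂ) Matrix.frobeniusNormedAddCommGroup Matrix.frobeniusNormedSpace e * (2 * Real.sqrt (Fintype.card mm)) * (Real.sqrt (Fintype.card mm) * (2 * (rA * ((((L ^ kk : ℕ) : ℝ))⁻¹)))))) ^ ((d + 2) * L ^ kk) - 1)) * (B4Sect5Proof.latticeConst (d + 1) δ₁ * Real.exp (3 * δ₁))) ≤ |a| * (3 * ((1 + Fintype.card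 ι * (@basisConst ι _ (Matrix mm mm ℂ) Matrix.frobeniusNormedAddCommGroup Matrix.frobeniusNormedSpace e * (2 * Real.sqrt (Fintype.card mm)) * (Real.sqrt (Fintype.card mm) * (2 * (rA * ((((L ^ kk : ℕ) : ℝ))⁻¹)))))) ^ ((d + 2) * L ^ kk) - 1) * (B4Sect5Proof.latticeConst (d + 1) δ₁ * Real.exp (3 * δ₁))) := by gcongr
      _ = 3 * |a| * (B4Sect5Proof.latticeConst (d + 1) δ₁ * Real.exp (3 * δ₁)) * ((1 + Fintype.card ι * (@basisConst ι _ (Matrix mm mm ℂ) Matrix.frobeniusNormedAddCommGroup Matrix.frobeniusNormedSpace e * (2 * Real.sqrt (Fintype.card mm)) * (Real.sqrt (Fintype.card mm) * (2 * (rA * ((((L ^ kk : ℕ) : ℝ))⁻¹)))))) ^ ((d + 2) * L ^ kk) - 1) := by ring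
      _ ≤ Rq * ((1 + Fintype.card ι * (@basisConst ι _ (Matrix mm mm ℂ) Matrix.frobeniusNormedAddCommGroup Matrix.frobeniusNormedSpace e * (2 * Real.sqrt (Fintype.card mm)) * (Real.sqrt (Fintype.card mm) * (2 * (rA * ((((L ^ kk : ℕ) : ℝ))⁻¹)))))) ^ ((d + 2) * L ^ kk) - 1) := mul_le_mul_of_nonneg_right (by rw [hRqdef]; nlinarith [mul_nonneg (abs_nonneg a) hce2]) hKC0
      _ ≤ Rq * (((1 + Fintype.card ι * (@basisConst ι _ (Matrix mm mm ℂ) Matrix.frobeniusNormedAddCommGroup Matrix.frobeniusNormedSpace e * (2 * Real.sqrt (Fintype.card mm)) * (Real.sqrt (Fintype.card mm) * (2 * (rA * ((((L ^ kk : ℕ) : ℝ))⁻¹)))))) ^ ((d + 2) * L ^ kk) - 1) + ((1 + Fintype.card ι * (@basisConst ι _ (Matrix mm mm ℂ) Matrix.frobeniusNormedAddCommGroup Matrix.frobeniusNormedSpace e * (2 * Real.sqrt (Fintype.card mm)) * (Real.sqrt (Fintype.card mm) * (2 * (rA * ((((L ^ r * L ^ kk : ℕ) : ℝ))⁻¹))))))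 ^ ((d + 2) * (L ^ r * L ^ kk)) - 1)) := mul_le_mul_of_nonneg_left (le_add_of_nonneg_right hKF0) hRq0
  have hconstF : |a| * (((1 + Fintype.card ι * (@basisConst ι _ (Matrix mm mm ℂ) Matrix.frobeniusNormedAddCommGroup Matrix.frobeniusNormedSpace e * (2 * Real.sqrt (Fintype.card mm)) * (Real.sqrt (Fintype.card mm) * (2 * (rA * ((((L ^ r * L ^ kk : ℕ) : ℝ))⁻¹)))))) ^ ((d + 2) * (L ^ r * L ^ kk)) - 1) * (2 + ((1 + Fintype.card ι * (@basisConst ι _ (Matrix mm mm ℂ) Matrix.frobeniusNormedAddCommGroup Matrix.frobeniusNormedSpace e * (2 * Real.sqrt (Fintype.card mm)) * (Real.sqrt (Fintype.card mm) * (2 * (rA * ((((L ^ r * L ^ kk : ℕ) : ℝ))⁻¹)))))) ^ ((d + 2) * (L ^ r * L ^ kk)) - 1)) * (B4Sect5Proof.latticeConst (d + 1) δ₂ * Real.exp (3 * δ₂))) ≤ Rq * (((1 + Fintype.card ι * (@basisConst ι _ (Matrix mm mm ℂ) Matrix.frobeniusNormedAddCommGroup Matrix.frobeniusNormedSpace e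 * (2 * Real.sqrt (Fintype.card mm)) * (Real.sqrt (Fintype.card mm) * (2 * (rA * ((((L ^ kk : ℕ) : ℝ))⁻¹)))))) ^ ((d + 2) * L ^ kk) - 1) + ((1 + Fintype.card ι * (@basisConst ι _ (Matrix mm mm ℂ) Matrix.frobeniusNormedAddCommGroup Matrix.frobeniusNormedSpace e * (2 * Real.sqrt (Fintype.card mm)) * (Real.sqrt (Fintype.card mm) * (2 * (rA * ((((L ^ r * L ^ kk : ℕ) : ℝ))⁻¹)))))) ^ ((d + 2) * (L ^ r * L ^ kk)) - 1)) := by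
    have h3 : ((1 + Fintype.card ι * (@basisConst ι _ (Matrix mm mm ℂ) Matrix.frobeniusNormedAddCommGroup Matrix.frobeniusNormedSpace e * (2 * Real.sqrt (Fintype.card mm)) * (Real.sqrt (Fintype.card mm) * (2 * (rA * ((((L ^ r * L ^ kk : ℕ) : ℝ))⁻¹)))))) ^ ((d + 2) * (L ^ r * L ^ kk)) - 1) * (2 + ((1 + Fintype.card ι * (@basisConst ι _ (Matrix mm mm ℂ) Matrix.frobeniusNormedAddCommGroup Matrix.frobeniusNormedSpace e * (2 * Real.sqrt (Fintype.card mm)) * (Real.sqrt (Fintype.card mm) * (2 * (rA * ((((L ^ r * L ^ kk : ℕ) : ℝ))⁻¹)))))) ^ ((d + 2) * (L ^ r * L ^ kk)) - 1)) ≤ 3 * ((1 + Fintype.card ι * (@basisConst ι _ (Matrix mm mm ℂ) Matrix.frobeniusNormedAddCommGroup Matrix.frobeniusNormedSpace e * (2 * Real.sqrt (Fintype.card mm)) * (Real.sqrt (Fintype.card mm) * (2 * (rA * ((((L ^ r * L ^ kk : ℕ) : ℝ))⁻¹)))))) ^ ((d + 2) * (L ^ r * L ^ kk)) - 1) := by 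nlinarith
    calc |a| * (((1 + Fintype.card ι * (@basisConst ι _ (Matrix mm mm ℂ) Matrix.frobeniusNormedAddCommGroup Matrix.frobeniusNormedSpace e * (2 * Real.sqrt (Fintype.card mm)) * (Real.sqrt (Fintype.card mm) * (2 * (rA * ((((L ^ r * L ^ kk : ℕ) : ℝ))⁻¹)))))) ^ ((d + 2) * (L ^ r * L ^ kk)) - 1) * (2 + ((1 + Fintype.card ι * (@basisConst ι _ (Matrix mm mm ℂ) Matrix.frobeniusNormedAddCommGroup Matrix.frobeniusNormedSpace e * (2 * Real.sqrt (Fintype.card mm)) * (Real.sqrt (Fintype.card mm) * (2 * (rA * ((((L ^ r * L ^ kk : ℕ) : ℝ))⁻¹)))))) ^ ((d + 2) * (L ^ r * L ^ kk)) - 1)) * (B4Sect5Proof.latticeConst (d + 1) δ₂ * Real.exp (3 * δ₂))) ≤ |a| * (3 * ((1 + Fintype.card ι * (@basisConst ι _ (Matrix mm mm ℂ) Matrix.frobeniusNormedAddCommGroup Matrix.frobeniusNormedSpace e * (2 * Real.sqrt (Fintype.card mm)) * (Real.sqrt (Fintype.card mm) * (2 * (rA * ((((L ^ r * L ^ kk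 : ℕ) : ℝ))⁻¹)))))) ^ ((d + 2) * (L ^ r * L ^ kk)) - 1) * (B4Sect5Proof.latticeConst (d + 1) δ₂ * Real.exp (3 * δ₂))) := by gcongr
      _ = 3 * |a| * (B4Sect5Proof.latticeConst (d + 1) δ₂ * Real.exp (3 * δ₂)) * ((1 + Fintype.card ι * (@basisConst ι _ (Matrix mm mm ℂ) Matrix.frobeniusNormedAddCommGroup Matrix.frobeniusNormedSpace e * (2 * Real.sqrt (Fintype.card mm)) * (Real.sqrt (Fintype.card mm) * (2 * (rA * ((((L ^ r * L ^ kk : ℕ) : ℝ))⁻¹)))))) ^ ((d + 2) * (L ^ r * L ^ kk)) - 1) := by ring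
      _ ≤ Rq * ((1 + Fintype.card ι * (@basisConst ι _ (Matrix mm mm ℂ) Matrix.frobeniusNormedAddCommGroup Matrix.frobeniusNormedSpace e * (2 * Real.sqrt (Fintype.card mm)) * (Real.sqrt (Fintype.card mm) * (2 * (rA * ((((L ^ r * L ^ kk : ℕ) : ℝ))⁻¹)))))) ^ ((d + 2) * (L ^ r * L ^ kk)) - 1) := mul_le_mul_of_nonneg_right (by rw [hRqdef]; nlinarith [mul_nonneg (abs_nonneg a) hce1]) hKF0
      _ ≤ Rq * (((1 + Fintype.card ι * (@basisConst ι _ (Matrix mm mm ℂ) Matrix.frobeniusNormedAddCommGroup Matrix.frobeniusNormedSpace e * (2 * Real.sqrt (Fintype.card mm)) * (Real.sqrt (Fintype.card mm) * (2 * (rA * ((((L ^ kk : ℕ) : ℝ))⁻¹)))))) ^ ((d + 2) * L ^ kk) - 1) + ((1 + Fintype.card ι * (@basisConst ι _ (Matrix mm mm ℂ) Matrix.frobeniusNormedAddCommGroup Matrix.frobeniusNormedSpace e * (2 * Real.sqrt (Fintype.card mm)) * (Real.sqrt (Fintype.card mm) * (2 * (rA * ((((L ^ r * L ^ kk : ℕ)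 : ℝ))⁻¹)))))) ^ ((d + 2) * (L ^ r * L ^ kk)) - 1)) := mul_le_mul_of_nonneg_left (le_add_of_nonneg_left hKC0) hRq0
  have hRN0 : 0 ≤ Rq * (((1 + Fintype.card ι * (@basisConst ι _ (Matrix mm mm ℂ) Matrix.frobeniusNormedAddCommGroup Matrix.frobeniusNormedSpace e * (2 * Real.sqrt (Fintype.card mm)) * (Real.sqrt (Fintype.card mm) * (2 * (rA * ((((L ^ kk : ℕ) : ℝ))⁻¹)))))) ^ ((d + 2) * L ^ kk) - 1) + ((1 + Fintype.card ι * (@basisConst ι _ (Matrix mm mm ℂ) Matrix.frobeniusNormedAddCommGroup Matrix.frobeniusNormedSpace e * (2 * Real.sqrt (Fintype.card mm)) * (Real.sqrt (Fintype.card mm) * (2 * (rA * ((((L ^ r * L ^ kk : ℕ) : ℝ))⁻¹)))))) ^ ((d + 2) * (L ^ r * L ^ kk)) - 1)) := mul_nonneg hRq0 (add_nonneg hKC0 hKF0)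
  -- (P-Q) the one-grid rows of `N_V^Q` (coarse, FILE 120's norm) and of `N_V^Q′` (fine, FILE 122's norm)
  have rowC : ∀ (f χ : CvX d L mv kk hL → ℝ), (∀ x, |f x| ≤ 1) → (∀ x, |χ x| ≤ 1) →
      HasMaj (CvNorm d L mv kk hL ι) (CvNorm d L mv kk hL ι) (mulOp (fun p : CvX d L mv kk hL × ι => f p.1) ∘ₗ (cvNVq d L mv kk hL a ι e (fun μ x => NormedSpace.exp (((((L ^ kk : ℕ) : ℝ))⁻¹) • gavgM (Matrix mm mm ℂ) (Fin (d + 1)) (kingPrV L kk r (cvM d L mv kk hL)) A' μ x))) ∘ₗ mulOp (fun p : CvX d L mv kk hL × ι => χ p.1))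
        (fun y y' => Rq * (((1 + Fintype.card ι * (@basisConst ι _ (Matrix mm mm ℂ) Matrix.frobeniusNormedAddCommGroup Matrix.frobeniusNormedSpace e * (2 * Real.sqrt (Fintype.card mm)) * (Real.sqrt (Fintype.card mm) * (2 * (rA * ((((L ^ kk : ℕ) : ℝ))⁻¹)))))) ^ ((d + 2) * L ^ kk) - 1) + ((1 + Fintype.card ι * (@basisConst ι _ (Matrix mm mm ℂ) Matrix.frobeniusNormedAddCommGroup Matrix.frobeniusNormedSpace e * (2 * Real.sqrt (Fintype.card mm)) * (Real.sqrt (Fintype.card mm) * (2 * (rA * ((((L ^ r * L ^ kk : ℕ) : ℝ))⁻¹)))))) ^ ((d + 2) * (L ^ r * L ^ kk)) - 1)) * Real.exp (-(δ₁ * (unitTorusGeo L kk (cvM d L mv kk hL)).dist y y'))) := fun f χ hf hχ' =>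
    (cv_hasMaj_sandwich_cvNVq e mv kk hL a hρc0 hδ₁ hTr hTc f χ hf hχ').mono fun y y' => mul_le_mul_of_nonneg_right hconstC (Real.exp_nonneg _)
  have hNVf := hasMaj_nvQ (L := L) (cvM d L mv kk hL) kk (L ^ r * L ^ kk) (T := cvT e (fun μ x' => NormedSpace.exp (((((L ^ r * L ^ kk : ℕ) : ℝ))⁻¹) • A' μ x'))) hρf0 hδ₂ hTr' hTc' a
  have rowF : ∀ (f' χ' : CvX' d L mv kk r hL → ℝ), (∀ x', |f' x'| ≤ 1) → (∀ x', |χ' x'| ≤ 1) →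
      HasMaj (BlockNorm.ofBlocks (unitTorusGeo L kk (cvM d L mv kk hL)) (liftBlk (fun b : CvX' d L mv kk r hL => blockOf (L ^ r * L ^ kk) (cvM d L mv kk hL) b.1) ι))
        (BlockNorm.ofBlocks (unitTorusGeo L kk (cvM d L mv kk hL)) (liftBlk (fun b : CvX' d L mv kk r hL => blockOf (L ^ r * L ^ kk) (cvM d L mv kk hL) b.1) ι))
        (mulOp (fun p : CvX' d L mv kk r hL × ι => f' p.1) ∘ₗ (cvNVq' d L mv kk r hL a ι e (fun μ x' => NormedSpace.exp (((((L ^ r * L ^ kk : ℕ) : ℝ))⁻¹) • A' μ x'))) ∘ₗ mulOp (fun p : CvX' d L mv kk r hL × ι => χ' p.1))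
        (fun y y' => Rq * (((1 + Fintype.card ι * (@basisConst ι _ (Matrix mm mm ℂ) Matrix.frobeniusNormedAddCommGroup Matrix.frobeniusNormedSpace e * (2 * Real.sqrt (Fintype.card mm)) * (Real.sqrt (Fintype.card mm) * (2 * (rA * ((((L ^ kk : ℕ) : ℝ))⁻¹)))))) ^ ((d + 2) * L ^ kk) - 1) + ((1 + Fintype.card ι * (@basisConst ι _ (Matrix mm mm ℂ) Matrix.frobeniusNormedAddCommGroup Matrix.frobeniusNormedSpace e * (2 * Real.sqrt (Fintype.card mm)) * (Real.sqrt (Fintype.card mm) * (2 * (rA * ((((L ^ r * L ^ kk : ℕ) : ℝ))⁻¹)))))) ^ ((d + 2) * (L ^ r * L ^ kk)) - 1)) * Real.exp (-(δ₂ * (unitTorusGeo L kk (cvM d L mv kk hL)).dist y y'))) := fun f' χ' hf hχ' => by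
    refine hasMaj_sandwich_of_abs_le_one (g := unitTorusGeo L kk (cvM d L mv kk hL)) (liftBlk (fun b : CvX' d L mv kk r hL => blockOf (L ^ r * L ^ kk) (cvM d L mv kk hL) b.1) ι)
      (N := (cvNVq' d L mv kk r hL a ι e (fun μ x' => NormedSpace.exp (((((L ^ r * L ^ kk : ℕ) : ℝ))⁻¹) • A' μ x')))) (K := fun y y' => Rq * (((1 + Fintype.card ι * (@basisConst ι _ (Matrix mm mm ℂ) Matrix.frobeniusNormedAddCommGroup Matrix.frobeniusNormedSpace e * (2 * Real.sqrt (Fintype.card mm)) * (Real.sqrt (Fintype.card mm) * (2 * (rA * ((((L ^ kk : ℕ) : ℝ))⁻¹)))))) ^ ((d + 2) * L ^ kk) - 1) + ((1 + Fintype.card ι * (@basisConst ι _ (Matrix mm mm ℂ) Matrix.frobeniusNormedAddCommGroup Matrix.frobeniusNormedSpace e * (2 * Real.sqrt (Fintype.card mm)) * (Real.sqrt (Fintype.card mm) * (2 * (rA * ((((L ^ r * L ^ kk : ℕ) : ℝ))⁻¹)))))) ^ ((d + 2) * (L ^ r * L ^ kk)) - 1)) * Real.exp (-(δ₂ * (unitTorusGeo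 L kk (cvM d L mv kk hL)).dist y y')))
      (ψ := fun p : CvX' d L mv kk r hL × ι => f' p.1) (χ := fun p : CvX' d L mv kk r hL × ι => χ' p.1) (fun p => hf p.1) (fun p => hχ' p.1)
      (fun y y' => mul_nonneg hRN0 (Real.exp_nonneg _)) ?_
    exact hNVf.mono fun y y' => by rw [unitTorusGeo_dist]; exact mul_le_mul_of_nonneg_right hconstF (Real.exp_nonneg _)
  -- the scale conditions at each level
  have hR₁le : (14 * Real.exp 1 * (1 + Fintype.card (Fin (d + 1))) * basisConst e * ((1 + Fintype.card (Fin (d + 1))) * ((3 + 2 * ((d : ℝ) + 1)) * rA))) * (1 + Fintype.card (Fin (d + 1) ⊕ Fin (d + 1))) + Rq * (((1 + Fintype.card ι * (@basisConst ι _ (Matrix mm mm ℂ) Matrix.frobeniusNormedAddCommGroup Matrix.frobeniusNormedSpace e * (2 * Real.sqrt (Fintype.card mm)) * (Real.sqrt (Fintype.card mm) * (2 * (rA * ((((L ^ kk : ℕ) : ℝ))⁻¹)))))) ^ ((d + 2) * L ^ kk) - 1) + ((1 + Fintype.card ι * (@basisConst ι _ (Matrix mm mm ℂ) Matrix.frobeniusNormedAddCommGroup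 Matrix.frobeniusNormedSpace e * (2 * Real.sqrt (Fintype.card mm)) * (Real.sqrt (Fintype.card mm) * (2 * (rA * ((((L ^ r * L ^ kk : ℕ) : ℝ))⁻¹)))))) ^ ((d + 2) * (L ^ r * L ^ kk)) - 1)) ≤ R₁' := hRle.trans (min_le_left _ _)
  have hR₂le : (14 * Real.exp 1 * (1 + Fintype.card (Fin (d + 1))) * basisConst e * ((1 + Fintype.card (Fin (d + 1))) * ((3 + 2 * ((d : ℝ) + 1)) * rA))) * (1 + Fintype.card (Fin (d + 1) ⊕ Fin (d + 1))) + Rq * (((1 + Fintype.card ι * (@basisConst ι _ (Matrix mm mm ℂ) Matrix.frobeniusNormedAddCommGroup Matrix.frobeniusNormedSpace e * (2 * Real.sqrt (Fintype.card mm)) * (Real.sqrt (Fintype.card mm) * (2 * (rA * ((((L ^ kk : ℕ) : ℝ))⁻¹)))))) ^ ((d + 2) * L ^ kk) - 1) + ((1 + Fintype.card ι * (@basisConst ι _ (Matrix mm mm ℂ) Matrix.frobeniusNormedAddCommGroup Matrix.frobeniusNormedSpace e * (2 * Real.sqrt (Fintype.card mm)) * (Real.sqrt (Fintype.card mm) *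 (2 * (rA * ((((L ^ r * L ^ kk : ℕ) : ℝ))⁻¹)))))) ^ ((d + 2) * (L ^ r * L ^ kk)) - 1)) ≤ R₂ := hRle.trans (min_le_right _ _)
  have hθ₁le : Rq * (((1 + Fintype.card ι * (@basisConst ι _ (Matrix mm mm ℂ) Matrix.frobeniusNormedAddCommGroup Matrix.frobeniusNormedSpace e * (2 * Real.sqrt (Fintype.card mm)) * (Real.sqrt (Fintype.card mm) * (2 * (rA * ((((L ^ kk : ℕ) : ℝ))⁻¹)))))) ^ ((d + 2) * L ^ kk) - 1) + ((1 + Fintype.card ι * (@basisConst ι _ (Matrix mm mm ℂ) Matrix.frobeniusNormedAddCommGroup Matrix.frobeniusNormedSpace e * (2 * Real.sqrt (Fintype.card mm)) * (Real.sqrt (Fintype.card mm) * (2 * (rA * ((((L ^ r * L ^ kk : ℕ) : ℝ))⁻¹)))))) ^ ((d + 2) * (L ^ r * L ^ kk)) - 1)) ≤ θ₁ := hθle.trans (min_le_left _ _)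
  have hθ₂le : Rq * (((1 + Fintype.card ι * (@basisConst ι _ (Matrix mm mm ℂ) Matrix.frobeniusNormedAddCommGroup Matrix.frobeniusNormedSpace e * (2 * Real.sqrt (Fintype.card mm)) * (Real.sqrt (Fintype.card mm) * (2 * (rA * ((((L ^ kk : ℕ) : ℝ))⁻¹)))))) ^ ((d + 2) * L ^ kk) - 1) + ((1 + Fintype.card ι * (@basisConst ι _ (Matrix mm mm ℂ) Matrix.frobeniusNormedAddCommGroup Matrix.frobeniusNormedSpace e * (2 * Real.sqrt (Fintype.card mm)) * (Real.sqrt (Fintype.card mm) * (2 * (rA * ((((L ^ r * L ^ kk : ℕ) : ℝ))⁻¹)))))) ^ ((d + 2) * (L ^ r * L ^ kk)) - 1)) ≤ θ₂ := hθle.trans (min_le_right _ _)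
  obtain ⟨hG, hGi₁, hGi₂⟩ := H₁ mv kk hk hw₁ e he (fun _ _ => (1 : Matrix mm mm ℂ)) (fun _ _ => by rw [Matrix.conjTranspose_one, Matrix.mul_one]) (fun μ x => NormedSpace.exp (((((L ^ kk : ℕ) : ℝ))⁻¹) • gavgM (Matrix mm mm ℂ) (Fin (d + 1)) (kingPrV L kk r (cvM d L mv kk hL)) A' μ x)) (cvNL d L mv kk hL a ι - (cvNVq d L mv kk hL a ι e (fun μ x => NormedSpace.exp (((((L ^ kk : ℕ) : ℝ))⁻¹) • gavgM (Matrix mm mm ℂ) (Fin (d + 1)) (kingPrV L kk r (cvM d L mv kk hL)) A' μ x)))) (fun _ => (cvNVq d L mv kk hL a ι e (fun μ x => NormedSpace.exp (((((L ^ kk : ℕ) : ℝ))⁻¹) • gavgM (Matrix mm mm ℂ) (Fin (d + 1)) (kingPrV L kk r (cvM d L mv kk hL)) A' μ x))))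
    (14 * Real.exp 1 * (1 + Fintype.card (Fin (d + 1))) * basisConst e * ((1 + Fintype.card (Fin (d + 1))) * ((3 + 2 * ((d : ℝ) + 1)) * rA))) (Rq * (((1 + Fintype.card ι * (@basisConst ι _ (Matrix mm mm ℂ) Matrix.frobeniusNormedAddCommGroup Matrix.frobeniusNormedSpace e * (2 * Real.sqrt (Fintype.card mm)) * (Real.sqrt (Fintype.card mm) * (2 * (rA * ((((L ^ kk : ℕ) : ℝ))⁻¹)))))) ^ ((d + 2) * L ^ kk) - 1) + ((1 + Fintype.card ι * (@basisConst ι _ (Matrix mm mm ℂ) Matrix.frobeniusNormedAddCommGroup Matrix.frobeniusNormedSpace e * (2 * Real.sqrt (Fintype.card mm)) * (Real.sqrt (Fintype.card mm) * (2 * (rA * ((((L ^ r * L ^ kk : ℕ) : ℝ))⁻¹)))))) ^ ((d + 2) * (L ^ r * L ^ kk)) - 1))) (Rq * (((1 + Fintype.card ι * (@basisConst ι _ (Matrix mm mm ℂ) Matrix.frobeniusNormedAddCommGroup Matrix.frobeniusNormedSpace e * (2 * Real.sqrt (Fintype.card mm)) * (Real.sqrt (Fintype.card mm) * (2 * (rA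 * ((((L ^ kk : ℕ) : ℝ))⁻¹)))))) ^ ((d + 2) * L ^ kk) - 1) + ((1 + Fintype.card ι * (@basisConst ι _ (Matrix mm mm ℂ) Matrix.frobeniusNormedAddCommGroup Matrix.frobeniusNormedSpace e * (2 * Real.sqrt (Fintype.card mm)) * (Real.sqrt (Fintype.card mm) * (2 * (rA * ((((L ^ r * L ^ kk : ℕ) : ℝ))⁻¹)))))) ^ ((d + 2) * (L ^ r * L ^ kk)) - 1))) hS0 hRN0 hRN0 hR₁le hθ₁le (fun k => conj_one_cvNL_sub_cvNVq mv kk hL a e _)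
    (fun k x _ i => hc x i) (fun k j' x _ i => hcA j' x i)
    (fun k => rowC (cvPsi d L mv kk hL k) (cvChi d L mv kk hL k) (hψ1 k) (hχ1 k))
    (fun k => by rw [hid k]; exact rowC (1 - cvPsi d L mv kk hL k) (cvChi d L mv kk hL k) (h1ψ k) (hχ1 k))
  obtain ⟨hG', hGi₁', hGi₂'⟩ := H₂ mv kk r hk hw₂ e he (fun _ _ => (1 : Matrix mm mm ℂ)) (fun _ _ => by rw [Matrix.conjTranspose_one, Matrix.mul_one]) (fun μ x' => NormedSpace.exp (((((L ^ r * L ^ kk : ℕ) : ℝ))⁻¹) • A' μ x')) (cvNL' d L mv kk r hL a ι - (cvNVq' d L mv kk r hL a ι e (fun μ x' => NormedSpace.exp (((((L ^ r * L ^ kk : ℕ) : ℝ))⁻¹) • A' μ x')))) (fun _ => (cvNVq' d L mv kk r hL a ι e (fun μ x' => NormedSpace.exp (((((L ^ r * L ^ kk : ℕ) : ℝ))⁻¹) • A' μ x'))))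
    (14 * Real.exp 1 * (1 + Fintype.card (Fin (d + 1))) * basisConst e * ((1 + Fintype.card (Fin (d + 1))) * ((3 + 2 * ((d : ℝ) + 1)) * rA))) (Rq * (((1 + Fintype.card ι * (@basisConst ι _ (Matrix mm mm ℂ) Matrix.frobeniusNormedAddCommGroup Matrix.frobeniusNormedSpace e * (2 * Real.sqrt (Fintype.card mm)) * (Real.sqrt (Fintype.card mm) * (2 * (rA * ((((L ^ kk : ℕ) : ℝ))⁻¹)))))) ^ ((d + 2) * L ^ kk) - 1) + ((1 + Fintype.card ι * (@basisConst ι _ (Matrix mm mm ℂ) Matrix.frobeniusNormedAddCommGroup Matrix.frobeniusNormedSpace e * (2 * Real.sqrt (Fintype.card mm)) * (Real.sqrt (Fintype.card mm) * (2 * (rA * ((((L ^ r * L ^ kk : ℕ) : ℝ))⁻¹)))))) ^ ((d + 2) * (L ^ r * L ^ kk)) - 1))) (Rq * (((1 + Fintype.card ι * (@basisConst ι _ (Matrix mm mm ℂ) Matrix.frobeniusNormedAddCommGroup Matrix.frobeniusNormedSpace e * (2 * Real.sqrt (Fintype.card mm)) * (Real.sqrt (Fintype.card mm) * (2 * (rA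 * ((((L ^ kk : ℕ) : ℝ))⁻¹)))))) ^ ((d + 2) * L ^ kk) - 1) + ((1 + Fintype.card ι * (@basisConst ι _ (Matrix mm mm ℂ) Matrix.frobeniusNormedAddCommGroup Matrix.frobeniusNormedSpace e * (2 * Real.sqrt (Fintype.card mm)) * (Real.sqrt (Fintype.card mm) * (2 * (rA * ((((L ^ r * L ^ kk : ℕ) : ℝ))⁻¹)))))) ^ ((d + 2) * (L ^ r * L ^ kk)) - 1))) hS0 hRN0 hRN0 hR₂le hθ₂le (fun k => conj_one_cvNL'_sub_cvNVq' mv kk r hL a e _)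
    (fun k x' _ i => hc' x' i) (fun k j' x' _ i => hcA' j' x' i)
    (fun k => rowF (cvPsi' d L mv kk r hL k) (cvChi' d L mv kk r hL k) (hψ1' k) (hχ1' k))
    (fun k => by rw [hid' k]; exact rowF (1 - cvPsi' d L mv kk r hL k) (cvChi' d L mv kk r hL k) (h1ψ' k) (hχ1' k))
  refine ⟨⟨hG.mono fun y y' => ?_, hGi₁, hGi₂⟩, ⟨hG'.mono fun y y' => ?_, hGi₁', hGi₂'⟩⟩
  · have hd0 := unitTorusGeo_dist_nonneg L kk (cvM d L mv kk hL) y y'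
    exact mul_le_mul (le_max_left _ _) (Real.exp_le_exp.mpr (neg_le_neg (mul_le_mul_of_nonneg_right (min_le_left _ _) hd0))) (Real.exp_nonneg _)
      ((hB₁.le).trans (le_max_left _ _))
  · have hd0 := unitTorusGeo_dist_nonneg L kk (cvM d L mv kk hL) y y'
    exact mul_le_mul (le_max_right _ _) (Real.exp_le_exp.mpr (neg_le_neg (mul_le_mul_of_nonneg_right (min_le_right _ _) hd0))) (Real.exp_nonneg _)
      ((hB₁.le).trans (le_max_left _ _))

end Pair

end Summit.QuantumFields.YangMills.BalabanUVNodes.N15.Gluing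

end
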